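import Mathlib
import Summits.NavierStokesRegularity.NavierStokesRegularity.Theorems.FilamentSkeletonRssStadiumPolygonalTubeShift

/-!
# Route `FilamentSkeletonRss` · cruxes `SkeletonJ1L` (stmt-NavierStokesRegularity-23296, registered stub `stub_tangentSkeletonL` ≡
# `TangentSkeletonNearStraightL`, stmt-23320) · line `child_tangent_analytic_strip_L` (b0b56c52900dd90a), stub `stub_stripPropagation` —
# brick for the freeze step of `rcore`: THE TENT FREEZE IDENTITY (own tent of the target = tent of the anchor, same kernel)

The continued own-filament field at a target `z` is the integral of the kernel of target `z` over the TENT OF `z`: left foot `(−∞, ℓ]` (real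
sources), a polygon `P' 0 = ℓ → P' 1 → ⋯ → P' n = r` of complex sources, right foot `[r, ∞)`.  Holomorphy in `z` near an anchor `z₀` needs
the same integral over the FIXED tent of `z₀` (feet `ℓ₀`, `r₀`, polygon `P`).  This file proves the identity of the two, for ONE kernel
(`f` on complex sources, `g` on real sources, `f = g` on the real trace), from three inputs:
(1) the polygonal tube shift (`Theorems.StadiumPolygonalTubeShift`: `f` holomorphic on the `δ`-tubes about the anchor's polygon, vertices moved `< δ/2`),
(2) the two real end junctions are interval integrals of `g` (`Theorems.StadiumRealJunction.real_junction_eq`),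
(3) `g` integrable on the four half-lines — then `∫_{Iic ℓ} g + Σ [P' k, P' (k+1)]_f + ∫_{Ioi r} g = ∫_{Iic ℓ₀} g + Σ [P k, P (k+1)]_f + ∫_{Ioi r₀} g`
(`tent_freeze`): the junctions are absorbed by the feet (`intervalIntegral.integral_Iic_sub_Iic`, `integral_Ioi_sub_Ioi'`).  Values in any
complete complex normed space; no stadium geometry enters.
HONEST FRAMING: a bookkeeping identity for a HYPOTHETICAL filament skeleton on the NEGATIVE side of a MODEL route; the stub `stub_stripPropagation`
is NOT closed by this file, `TangentSkeletonNearStraightL` / `SkeletonJ1L` stay OPEN; nothing here bears on Navier–Stokes regularity or blow-up.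
`--supports stmt-NavierStokesRegularity-23320` (≡ stub `stub_tangentSkeletonL` of 23296).
-/

set_option linter.dupNamespace false

noncomputable section

namespace Summit.NavierStokesRegularity.NavierStokesRegularity.Theorems.StadiumTentFreeze

open Set Metric MeasureTheory Complex Finset
open Summit.NavierStokesRegularity.NavierStokesRegularity.Theorems.StadiumPolygonalTubeShift

variable {E : Type*} [NormedAddCommGroup E] [NormedSpace ℝ E] [NormedSpace ℂ E] [IsScalarTower ℝ ℂ E] [CompleteSpace E]

/-- **The tent freeze identity.**  `f` (complex sources) holomorphic on `U` ⊇ the open `δ`-discs about every point of the anchor's polygon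
`P 0 → ⋯ → P n`; the target's polygon `P'` has every vertex within `δ/2`; the end vertices are real: `P 0 = ℓ₀`, `P n = r₀`, `P' 0 = ℓ`,
`P' n = r`; the end junctions are interval integrals of the real-source kernel `g` (`[ℓ₀, ℓ]_f = ∫_{ℓ₀}^{ℓ} g`, `[r₀, r]_f = ∫_{r₀}^{r} g`);
`g` integrable on `Iic ℓ₀`, `Iic ℓ`, `Ioi r₀`, `Ioi r`.  Then the target's tent integral equals the anchor's tent integral. [folklore] -/
theorem tent_freeze {U : Set ℂ} {f : ℂ → E} (hf : DifferentiableOn ℂ f U) (P P' : ℕ → ℂ) {δ : ℝ} (hδ : 0 < δ) (n : ℕ)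
    (htube : ∀ k < n, ∀ t ∈ Icc (0:ℝ) 1, ball (P k + (t : ℂ) * (P (k+1) - P k)) δ ⊆ U)
    (hclose : ∀ k ≤ n, dist (P' k) (P k) < δ / 2)
    {ℓ₀ ℓ r₀ r : ℝ} (hP0 : P 0 = (ℓ₀ : ℂ)) (hP'0 : P' 0 = (ℓ : ℂ)) (hPn : P n = (r₀ : ℂ)) (hP'n : P' n = (r : ℂ))
    {g : ℝ → E}
    (hJL : (∫ t in (0:ℝ)..1, ((ℓ : ℂ) - (ℓ₀ : ℂ)) • f ((ℓ₀ : ℂ) + (t : ℂ) * ((ℓ : ℂ) - (ℓ₀ : ℂ)))) = ∫ σ in ℓ₀..ℓ, g σ)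
    (hJR : (∫ t in (0:ℝ)..1, ((r : ℂ) - (r₀ : ℂ)) • f ((r₀ : ℂ) + (t : ℂ) * ((r : ℂ) - (r₀ : ℂ)))) = ∫ σ in r₀..r, g σ)
    (hgL₀ : IntegrableOn g (Iic ℓ₀)) (hgL : IntegrableOn g (Iic ℓ))
    (hgR₀ : IntegrableOn g (Ioi r₀)) (hgR : IntegrableOn g (Ioi r)) :
    (∫ σ in Iic ℓ, g σ) + (∑ k ∈ range n, ∫ t in (0:ℝ)..1, (P' (k+1) - P' k) • f (P' k + (t : ℂ) * (P' (k+1) - P' k))) +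
        (∫ σ in Ioi r, g σ) =
      (∫ σ in Iic ℓ₀, g σ) + (∑ k ∈ range n, ∫ t in (0:ℝ)..1, (P (k+1) - P k) • f (P k + (t : ℂ) * (P (k+1) - P k))) +
        (∫ σ in Ioi r₀, g σ) := by
  -- (1) the polygonal tube shift
  have hpoly := polygonal_tube_shift hf P P' hδ n htube hclose
  rw [hP0, hP'0, hPn, hP'n, hJL, hJR] at hpoly
  -- (2)+(3) the junctions are feet differences
  have hL := intervalIntegral.integral_Iic_sub_Iic hgL₀ hgL      -- `∫_{Iic ℓ} − ∫_{Iic ℓ₀} = ∫_{ℓ₀..ℓ}`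
  have hR := intervalIntegral.integral_Ioi_sub_Ioi' hgR₀ hgR     -- `∫_{Ioi r₀} − ∫_{Ioi r} = ∫_{r₀..r}`
  -- bookkeeping
  have e1 : (∫ σ in Iic ℓ, g σ) = (∫ σ in Iic ℓ₀, g σ) + ∫ σ in ℓ₀..ℓ, g σ := by rw [← hL]; abel
  have e2 : (∫ σ in Ioi r, g σ) = (∫ σ in Ioi r₀, g σ) - ∫ σ in r₀..r, g σ := by rw [← hR]; abel
  have e3 : (∑ k ∈ range n, ∫ t in (0:ℝ)..1, (P' (k+1) - P' k) • f (P' k + (t : ℂ) * (P' (k+1) - P' k))) =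
      (∑ k ∈ range n, ∫ t in (0:ℝ)..1, (P (k+1) - P k) • f (P k + (t : ℂ) * (P (k+1) - P k))) +
        (∫ σ in r₀..r, g σ) - ∫ σ in ℓ₀..ℓ, g σ := by
    calc (∑ k ∈ range n, ∫ t in (0:ℝ)..1, (P' (k+1) - P' k) • f (P' k + (t : ℂ) * (P' (k+1) - P' k)))
        = ((∫ σ in ℓ₀..ℓ, g σ) +
            ∑ k ∈ range n, ∫ t in (0:ℝ)..1, (P' (k+1) - P' k) • f (P' k + (t : ℂ) * (P' (k+1) - P' k))) -
          ∫ σ in ℓ₀..ℓ, g σ := by abel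
      _ = ((∑ k ∈ range n, ∫ t in (0:ℝ)..1, (P (k+1) - P k) • f (P k + (t : ℂ) * (P (k+1) - P k))) +
            (∫ σ in r₀..r, g σ)) - ∫ σ in ℓ₀..ℓ, g σ := by rw [hpoly]
  rw [e1, e2, e3]
  abel

end Summit.NavierStokesRegularity.NavierStokesRegularity.Theorems.StadiumTentFreeze

end
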